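import Literature.IUT.HodgeArakelov.ThetaEvaluationModelEvCor112Model
import Literature.IUT.HodgeArakelov.TemperedCurveXuu
import Literature.AnabelianGeometry.SemiGraphs.TemperedDecompositionCompact

/-!
# [IUTchII] Cor 1.12 (ii)/(iii) at the model: the parameter `D_{μ_-}` INSTANTIATED as a decomposition group of the tempered
# curve `X̲̲_v` — the three decomposition-group facts `hDq` / `hDc` / `[(D_{μ_-}.map ε).FiniteIndex]` DISCHARGED (proof companion)

Proof-only companion (abc-iut cell, D-0067 wave 4, seat abc-iut-w4-d043 gen 4; nodes **IUTchII:Cor1.12(ii)**,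
**IUTchII:Cor1.12(iii)**; plan/L6/NODES.md standing input (α) «decomposition-group facts for the abstract parameter `D_{μ_-}`
(hDq, hDc, finite index — `TemperedCurve` fields … the day `D_{μ_-}` is instantiated)») of abc-iut-w4-d007's
`ThetaEvaluationModelEvOfTower.lean` (`EtaleLevels.cor112_ii_model_of_cyclotomeTower`, p425297) and abc-iut-w4-d043's
`ThetaEvaluationModelEvCor112Model.lean` (`EtaleLevels.cor112_model_of_cyclotomeTower`, p430492).  Those closers carry
print's decomposition group `D_{μ_-} ⊆ Π_Ÿ(Π) ⊆ Π := Π^tp_X̲̲` as an ABSTRACT subgroup `Dmu` with three named facts: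
`hDq : D_{μ_-} ∩ Δ = {1}`, `hDc : D_{μ_-}` compact, `[(D_{μ_-}.map ε).FiniteIndex]` (its image in `G_{ℚ_p}` has finite
index).  HERE `Dmu` is INSTANTIATED as the decomposition group `D_y ⊆ Π^tp_{X̲̲_v} = Π^tp_X̲̲` of a NON-CUSPIDAL closed point `y`
of the tree's tempered curve `X̲̲_v` (abc-iut-L6-t7's `DoubleUnderline.temperedCurveXuuOfLevelData`, an instance of abc-iut-L3's
`TemperedCurve.ofOpenSubgroup` at the open index-`l²` subgroup `Π^tp_X̲̲ = C.Huu ≤ Π^tp_X`, over the L3 parameter bundle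
`GroupLevelData` «`Π^temp` tempered, Galois-countable»), and the three facts are THEOREMS:
* `hDq` ← the interface law `TemperedCurve.inertia_eq_bot` ([SemiAnbd] §6 p. 71 «`I_x := D_x ∩ Δ^temp_X` is … `{1}` if
  `x` is not a cusp»), through L3's `decompOfOpenAt_inf_ker_eq_bot` for the covering `X̲̲_v → X_v`;
* `hDc` ← abc-iut-L3's `TemperedCurve.decompCompact_of_groupLevelData` (`TemperedDecompositionCompact.lean`: decomposition
  groups of a tempered, Galois-countable `Π^temp` are compact — open mapping theorem for tempered groups) at `X̲̲_v` with
  `DoubleUnderline.groupLevelDataXuu`;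
* finite index ← the interface law `TemperedCurve.isOpen_aug_decomp` ([SemiAnbd] §6 p. 71 «`D_x` always surjects onto an open
  subgroup of `G_K`») and the compactness of `G_{ℚ_p}` (an open subgroup of a compact group has finite index).
Consequently `cor112_ii_model_of_cyclotomeTower_decompPoint` / `cor112_model_of_cyclotomeTower_decompPoint`: the two closers
with `Dmu := D_y` and WITHOUT the hypotheses `hDq`, `hDc`, `[(Dmu.map ε).FiniteIndex]`, `[T2Space G_{ℚ_p}]` (the last by
`krullTopology_t2`).  What remains named ABOUT THE POINT is exactly «`y = μ_-`» in the printed sense: `hDmu : D_y ≤ Π_Ÿ(Π)`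
([IUTchII] Rmk. 1.4.1 (ii) p. 28 «`D_{μ_-} ⊆ Π_{Ÿ̲_k}`»), `hfixD` («`ι_Ÿ` … fix[es] … `(μ_-)_Ÿ`» up to `Δ`-conjugacy) and
`hstd` (standard type: the restriction of `η̈^Θ` to `D_{μ_-}` is a `2l`-th root of unity) — interface data of the L2/L3 point
`μ_-`, not facts about decomposition groups.  No definition, no `Prop`-valued fact; nothing of the parents is restated.

S. Mochizuki, *Inter-universal Teichmüller theory II*, kurims manuscript (Dec. 2020), Rmk. 1.4.1 (ii) p. 28, Cor. 1.12 (ii),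
(iii) pp. 56–58 [claim: Mochizuki2012, status: disputed] (IUTchII §1 Cor 1.12, kurims pp.56-58); S. Mochizuki, *Semi-graphs of
anabelioids*, Publ. RIMS **42** (2006), §6 p. 71 [cite: MochizukiSemiAnbd2006, §6 p.71].  Claim key DISPUTED (D-0012);
nothing here takes a side on [IUTchIII] Cor. 3.12; instantiated ≠ endorsed; typed ≠ proved for the remaining named inputs.
-/

noncomputable section

namespace Literature.IUT.HodgeArakelov

open Literature.AnabelianGeometry.EtaleTheta Literature.AnabelianGeometry.SemiGraphs CohomologySystemOfContH1
open Literature.AnabelianGeometry.AbsoluteAnabelian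
open scoped Literature.AnabelianGeometry.EtaleTheta

/-! ## §1. The three decomposition-group facts for `D_y ⊆ Π^tp_{X̲̲_v} = Π^tp_X̲̲` -/

namespace EtaleThetaDataOfSetting

variable {p : ℕ} [Fact p.Prime] {D : Literature.AnabelianGeometry.EtaleTheta.ThetaSetting p}
  {E : D.EtaleThetaData} {l : ℕ} (C : E.DoubleUnderline l)

/-- **`hDq` DISCHARGED for `Dmu := D_y`**: for a non-cuspidal closed point `y` of `X̲̲_v`, an element of the decomposition group
`D_y ⊆ Π^tp_X̲̲` with trivial image in `G_{ℚ_p}` is trivial — `D_y ∩ Δ^tp_{X̲̲_v} = I_y = {1}` ([SemiAnbd] §6 p. 71, interface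
law `inertia_eq_bot` of the tree's tempered curve `X̲̲_v`). [cite: MochizukiSemiAnbd2006, §6 p.71] -/
theorem decompPoint_eq_one_of_aug_eq_one (hl0 : l ≠ 0) (gd : D.toTemperedCurve.GroupLevelData)
    (y : (C.temperedCurveXuuOfLevelData hl0 gd).Pt) (hy : ¬ (C.temperedCurveXuuOfLevelData hl0 gd).IsCusp y) :
    ∀ g ∈ ((C.temperedCurveXuuOfLevelData hl0 gd).decomp y : Subgroup (Pi C)), aug C g = 1 → g = 1 := by
  intro g hg h1
  have hbot := (C.temperedCurveXuuOfLevelData hl0 gd).inertia_eq_bot y hy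
  have hmem : g ∈ (C.temperedCurveXuuOfLevelData hl0 gd).decomp y ⊓
      (C.temperedCurveXuuOfLevelData hl0 gd).aug.toMonoidHom.ker :=
    Subgroup.mem_inf.2 ⟨hg, MonoidHom.mem_ker.2 h1⟩
  rw [hbot] at hmem
  exact Subgroup.mem_bot.1 hmem

/-- **`hDc` DISCHARGED for `Dmu := D_y`**: the decomposition group `D_y ⊆ Π^tp_X̲̲` of a closed point `y` of `X̲̲_v` is COMPACT
(abc-iut-L3's `TemperedCurve.decompCompact_of_groupLevelData` — [SemiAnbd] §6 p. 71, tacit: `D_y` is tempered and maps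
openly onto an open, hence compact, subgroup of `G_{ℚ_p}` with compact kernel — at `X̲̲_v` with its parameter bundle
`groupLevelDataXuu`). [cite: MochizukiSemiAnbd2006, §6 p.71] -/
theorem isCompact_decompPoint (hl0 : l ≠ 0) (gd : D.toTemperedCurve.GroupLevelData)
    (y : (C.temperedCurveXuuOfLevelData hl0 gd).Pt) :
    IsCompact (X := Pi C)
      ((C.temperedCurveXuuOfLevelData hl0 gd).decomp y : Set (C.temperedCurveXuuOfLevelData hl0 gd).PiTemp) :=
  (C.temperedCurveXuuOfLevelData hl0 gd).decompCompact_of_groupLevelData (C.groupLevelDataXuu hl0 gd) y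

/-- The image of `D_y` in `G_{ℚ_p}` under the augmentation `ε : Π^tp_X̲̲ → G_{ℚ_p}` is OPEN ([SemiAnbd] §6 p. 71 «`D_x` always
surjects onto an open subgroup of `G_K`», interface law `isOpen_aug_decomp` of `X̲̲_v`; `G_K` is open in `G_{ℚ_p}`).
[cite: MochizukiSemiAnbd2006, §6 p.71] -/
theorem isOpen_map_aug_decompPoint (hl0 : l ≠ 0) (gd : D.toTemperedCurve.GroupLevelData)
    (y : (C.temperedCurveXuuOfLevelData hl0 gd).Pt) :
    IsOpen ((((C.temperedCurveXuuOfLevelData hl0 gd).decomp y : Subgroup (Pi C)).map (aug C) : Subgroup (GQp p)) :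
      Set (GQp p)) := by
  have h := (C.temperedCurveXuuOfLevelData hl0 gd).isOpen_aug_decomp y
  rw [Subgroup.coe_map]
  exact h

/-- **`[(Dmu.map ε).FiniteIndex]` DISCHARGED for `Dmu := D_y`**: the image of `D_y` in `G_{ℚ_p}` has FINITE INDEX — it is an
open subgroup (`isOpen_map_aug_decompPoint`) of the compact group `G_{ℚ_p} = Gal(ℚ̄_p/ℚ_p)` (Krull topology), and an open
subgroup of a compact group has finite index (the quotient is compact and discrete). [cite: MochizukiSemiAnbd2006, §6 p.71] -/
theorem finiteIndex_map_aug_decompPoint (hl0 : l ≠ 0) (gd : D.toTemperedCurve.GroupLevelData)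
    (y : (C.temperedCurveXuuOfLevelData hl0 gd).Pt) :
    (((C.temperedCurveXuuOfLevelData hl0 gd).decomp y : Subgroup (Pi C)).map (aug C)).FiniteIndex := by
  haveI : IsGalois ℚ_[p] (AlgebraicClosure ℚ_[p]) := {}
  have hopen := isOpen_map_aug_decompPoint C hl0 gd y
  haveI : DiscreteTopology (GQp p ⧸ ((C.temperedCurveXuuOfLevelData hl0 gd).decomp y : Subgroup (Pi C)).map (aug C)) :=
    QuotientGroup.discreteTopology_iff.mpr hopen
  haveI : Finite (GQp p ⧸ ((C.temperedCurveXuuOfLevelData hl0 gd).decomp y : Subgroup (Pi C)).map (aug C)) :=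
    finite_of_compact_of_discrete
  exact Subgroup.finiteIndex_of_finite_quotient

end EtaleThetaDataOfSetting

/-! ## §2. Cor. 1.12 (ii) / (ii)∧(iii) at the model with `D_{μ_-} := D_y` — the three facts no longer hypotheses -/

namespace EtaleLevels

variable {p : ℕ} [Fact p.Prime] {D : Literature.AnabelianGeometry.EtaleTheta.ThetaSetting p}
  {E : D.EtaleThetaData} {l : ℕ} (C : E.DoubleUnderline l) (hC : D.Compat) (hS : D.Sec2Hyps)
  (hl : l.Prime) (hp2 : p ≠ 2) (hpl : p ≠ l) (hζ : ∃ ζ : D.K, IsPrimitiveRoot ζ (4 * l))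
  (mods : ∀ M : ℕ+, D.CyclotomeMod l M)
  (f : contCocycles D.toTheta D.DeltaTheta C.GtpYdduu) (hf : f ∈ C.rootCocycles hC)
  (hmods : ∀ (M M' : ℕ+) (h : (M : ℕ) ∣ (M' : ℕ)) (x : D.lDeltaTheta l),
    MuN.red p M M' h ((mods M').red x) = (mods M).red x)
  (h15 : Literature.AnabelianGeometry.EtaleTheta.ThetaSetting.Prop15iii E hC) (L : C.CuspLabels)
  (hZ : ∀ M : ℕ+, Nonempty (ModelCyclotomes.lDeltaQuot (C.rigidData (mods M) hC hS h15 L) ≃*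
    Literature.IUT.HodgeTheaters.ZHat))
  (hcharY : EtaleThetaDataOfSetting.PiYddCharacteristic C)
  (hlim : Function.Bijective (rigidLimHom C hC hS hl hp2 hpl hζ mods f hf hmods h15 L hZ))
  (Env : EnvOfGroup (setting C hC hS hl hp2 hpl hζ mods f hf)
    (modelSystem C hC hS hl hp2 hpl hζ mods f hf hmods h15 L hZ).PiX)
  -- the model pointed inversion (abc-iut-w5-d072's `pointedInversionOfPair`): its named print inputs
  (α : (EtaleThetaDataOfSetting.Pi C) ≃ₜ* (EtaleThetaDataOfSetting.Pi C))
  (hover : ∀ x : EtaleThetaDataOfSetting.Pi C, Env.recon.projG (Env.isoX (α x)) = Env.recon.projG (Env.isoX x))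
  (δ : EtaleThetaDataOfSetting.Pi C) (hδ : Env.recon.projG (Env.isoX δ) = 1)
  (hαα : ∀ x : EtaleThetaDataOfSetting.Pi C, α (α x) = δ * x * δ⁻¹)
  (γ : EtaleThetaDataOfSetting.Pi C) (hγ : C.toLZ γ = Multiplicative.ofAdd 1)
  (hαγ : C.toLZ (α γ) = Multiplicative.ofAdd (-1))
  (huniq : ∀ κ : (EtaleThetaDataOfSetting.Pi C) ≃ₜ* (EtaleThetaDataOfSetting.Pi C),
    (∀ x, Env.recon.projG (Env.isoX (κ x)) = Env.recon.projG (Env.isoX x)) →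
    (∃ δ' : EtaleThetaDataOfSetting.Pi C, Env.recon.projG (Env.isoX δ') = 1 ∧ ∀ x, κ (κ x) = δ' * x * δ'⁻¹) →
    (¬ ∃ δ' : EtaleThetaDataOfSetting.Pi C, Env.recon.projG (Env.isoX δ') = 1 ∧ ∀ x, κ x = δ' * x * δ'⁻¹) →
      ∃ δ' : EtaleThetaDataOfSetting.Pi C, Env.recon.projG (Env.isoX δ') = 1 ∧ ∀ x, κ x = δ' * α x * δ'⁻¹)
  -- the L3 parameter bundle «`Π^temp` tempered, Galois-countable» of `X_v`, and the POINT: a non-cuspidal closed point `y` of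
  -- the tree's tempered curve `X̲̲_v`, whose decomposition group `D_y ⊆ Π^tp_X̲̲` instantiates print's `D_{μ_-}`
  (gd : D.toTemperedCurve.GroupLevelData)
  (y : (C.temperedCurveXuuOfLevelData hl.ne_zero gd).Pt) (hy : ¬ (C.temperedCurveXuuOfLevelData hl.ne_zero gd).IsCusp y)
  -- what «`y = μ_-`» means in print: `D_{μ_-} ⊆ Π_Ÿ(Π)`, fixed by `ι_Ÿ` up to `Δ`-conjugacy, standard type at `D_{μ_-}`
  (hDmu : (((C.temperedCurveXuuOfLevelData hl.ne_zero gd).decomp y : Subgroup (EtaleThetaDataOfSetting.Pi C))) ≤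
    EtaleThetaDataOfSetting.PiYdd C)
  (hfixD : ∃ δ' : ↥(EtaleThetaDataOfSetting.PiYdd C), Env.recon.projG (Env.isoX (δ' : EtaleThetaDataOfSetting.Pi C)) = 1 ∧
    ∀ (d : EtaleThetaDataOfSetting.Pi C) (hd : d ∈ ((C.temperedCurveXuuOfLevelData hl.ne_zero gd).decomp y)),
      ((EtaleThetaDataOfSetting.iotaYddOfAut C hcharY α ⟨d, hDmu hd⟩ :
      EtaleThetaDataOfSetting.PiYdd C) : EtaleThetaDataOfSetting.Pi C) ∈
        (((C.temperedCurveXuuOfLevelData hl.ne_zero gd).decomp y : Subgroup (EtaleThetaDataOfSetting.Pi C))).map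
          (MulAut.conj ((δ' : EtaleThetaDataOfSetting.PiYdd C) : EtaleThetaDataOfSetting.Pi C)).toMonoidHom)
  (etaStd : (EtaleThetaDataOfSetting.coh C).H1 ⊤) (hmem : etaStd ∈ EtaleThetaDataOfSetting.orbitOne C hC)
  (hstd : (2 * (setting C hC hS hl hp2 hpl hζ mods f hf).l) •
    EtaleThetaDataOfSetting.resDmuOf C ((C.temperedCurveXuuOfLevelData hl.ne_zero gd).decomp y) hDmu etaStd = 0)
  -- the coefficient half of the pair and its printed properties
  (β : D.GtpTheta ≃ₜ* D.GtpTheta)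
  (hφ : ∀ g, β (EtaleThetaDataOfSetting.phi C g) = EtaleThetaDataOfSetting.phi C (α g))
  (hAβ : ∀ a : D.GtpTheta, a ∈ D.lDeltaTheta l ↔ β a ∈ D.lDeltaTheta l)
  (hH : ∀ x, x ∈ EtaleThetaDataOfSetting.PiYdd C ↔ α x ∈ EtaleThetaDataOfSetting.PiYdd C)
  -- the GENUINE [AbsTopIII]-output data: base MLF `k ⊆ ℚ̄_p` (finite over `ℚ_p`, `k̄ = ℚ̄_p`), model identification `ε`,
  -- (H1) `Δ` characteristic, (H2) `Π/Δ ≅ G_k`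
  (k : Type) [Field k] [ValuativeRel k] [TopologicalSpace k] [IsNonarchimedeanLocalField k] [CharZero k]
  [Algebra k (PadicAlgCl p)] [IsAlgClosure k (PadicAlgCl p)]
  [Algebra ℚ_[p] k] [FiniteDimensional ℚ_[p] k] [IsScalarTower ℚ_[p] k (PadicAlgCl p)]
  (ε : (setting C hC hS hl hp2 hpl hζ mods f hf).Gk ≃ₜ*
    (ModelMLFGaloisData.galois ({ k := k, K := PadicAlgCl p } : MLFClosure.{0}).k
      ({ k := k, K := PadicAlgCl p } : MLFClosure.{0}).K).tmPair.Pi)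
  (hΔX : ∀ φ : (setting C hC hS hl hp2 hpl hζ mods f hf).PiX ≃ₜ* (setting C hC hS hl hp2 hpl hζ mods f hf).PiX,
    (setting C hC hS hl hp2 hpl hζ mods f hf).DeltaX.map φ.toMulEquiv.toMonoidHom =
      (setting C hC hS hl hp2 hpl hζ mods f hf).DeltaX)
  (hq : Nonempty (TopGroup.quot (setting C hC hS hl hp2 hpl hζ mods f hf).PiX (setting C hC hS hl hp2 hpl hζ mods f hf).DeltaX ≃ₜ*
    (setting C hC hS hl hp2 hpl hζ mods f hf).Gk))

/-- **[IUTchII] Cor. 1.12 (ii) at the model `Π := Π^tp_X̲̲` with `D_{μ_-} := D_y` INSTANTIATED — `hDq`, `hDc`,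
`[(D_{μ_-}.map ε).FiniteIndex]`, `[T2Space G_{ℚ_p}]` DISCHARGED.**  abc-iut-w4-d007's `cor112_ii_model_of_cyclotomeTower`
(the typed `Cor112_ii` — the splittings `(†μθ)(Π)` — for the model theta-evaluation datum over the model pointed inversion,
with a bijective change of coefficient cyclotome `cU : Λ(ℚ̄_pˣ) ⥲ l·Δ_Θ` inverse to the model's identifications) at the
pointed inversion whose decomposition group IS `D_y ⊆ Π^tp_X̲̲`, the decomposition group of a non-cuspidal closed point `y` of
the tree's tempered curve `X̲̲_v`: the three decomposition-group facts are the theorems of §1 and `G_{ℚ_p}` is Hausdorff by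
`krullTopology_t2`.  Residual named inputs: the Rmk. 1.4.1 (ii) data `α … huniq`, «`y = μ_-`» (`hDmu`, `hfixD`, `etaStd`/
`hmem`/`hstd`), `β`/`hφ`/`hAβ`/`hH`, `hα`/`hβ`, `τ`/`hτ`/`hdesc`/`hrev`/`hfree`, `hO` (F-2498), `hΔ` (G-w5d187-1), and the
L3 parameter bundle `gd`. [claim: Mochizuki2012, status: disputed] (IUTchII §1 Cor 1.12 (ii), kurims pp.56-58) -/
theorem cor112_ii_model_of_cyclotomeTower_decompPoint
    (hO : D.IsEtThOrigin) (hΔ : IsCompact (D.DeltaTheta : Set D.GtpTheta))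
    (hα : ∀ x, EtaleThetaDataOfSetting.aug C (α x) = EtaleThetaDataOfSetting.aug C x)
    (hβ : ∀ a : D.GtpTheta, a ∈ D.lDeltaTheta l → β a = a)
    (τ : ℤ → (EtaleThetaDataOfSetting.coh C).H1 ⊤) (hτ : τ 0 = etaStd)
    (hdesc : ∀ o ∈ EtaleThetaDataOfSetting.orbitOne C hC,
      ∃ (n : ℤ) (c' : (EtaleThetaDataOfSetting.coh C).H1 ⊤), 2 • c' = 0 ∧ o = τ n + c')
    (hrev : ∀ n : ℤ, IsOfFinAddOrder (EtaleThetaDataOfSetting.pairRho C α β hφ hAβ hH (τ n) - τ (-n)))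
    (hfree : ∀ m n : ℤ, IsOfFinAddOrder (τ m - τ n) → m = n) :
    haveI := EtaleThetaDataOfSetting.finiteIndex_map_aug_decompPoint C hl.ne_zero gd y
    ∃ cU : CyclotomeCoefficients (EtaleThetaDataOfSetting.phi C) (D.lDeltaTheta l) (PadicAlgCl p)ˣ,
      Function.Bijective cU.hom ∧
      (∀ (ζ : Literature.AnabelianGeometry.EtaleTheta.cyclotome (PadicAlgCl p)ˣ) (M : ℕ+),
        (((mods M).red (cU.hom ζ) : MuN p M) : (PadicAlgCl p)ˣ) = (ζ : ℕ+ → (PadicAlgCl p)ˣ) M) ∧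
      Literature.IUT.HodgeArakelov.Cor112_ii
        (thetaEvaluation C hC hS hl hp2 hpl hζ mods f hf hmods h15 L hZ hcharY hlim Env
          (EtaleThetaDataOfSetting.pointedInversionOfPair C hC hS hcharY (setting C hC hS hl hp2 hpl hζ mods f hf)
            (ContinuousMulEquiv.refl _) rfl Env α hover δ hδ hαα γ hγ hαγ huniq ((C.temperedCurveXuuOfLevelData hl.ne_zero gd).decomp y) hDmu hfixD etaStd hmem hstd)
          (LevelRetraction.ofAugmentation (EtaleThetaDataOfSetting.phi C) (D.lDeltaTheta l)
            (EtaleThetaDataOfSetting.aug C) ((C.temperedCurveXuuOfLevelData hl.ne_zero gd).decomp y) (EtaleThetaDataOfSetting.decompPoint_eq_one_of_aug_eq_one C hl.ne_zero gd y hy) (EtaleThetaDataOfSetting.PiYdd C)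
            (EtaleThetaDataOfSetting.continuous_aug C) (aug_ker_acts_trivially C)
            (hlift_of_isCompact (EtaleThetaDataOfSetting.aug C) ((C.temperedCurveXuuOfLevelData hl.ne_zero gd).decomp y) (EtaleThetaDataOfSetting.continuous_aug C) (EtaleThetaDataOfSetting.isCompact_decompPoint C hl.ne_zero gd y))
            (hemb_of_isCompact (EtaleThetaDataOfSetting.aug C) ((C.temperedCurveXuuOfLevelData hl.ne_zero gd).decomp y) (EtaleThetaDataOfSetting.continuous_aug C) (EtaleThetaDataOfSetting.isCompact_decompPoint C hl.ne_zero gd y) (EtaleThetaDataOfSetting.decompPoint_eq_one_of_aug_eq_one C hl.ne_zero gd y hy)))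
          cU (EtaleThetaDataOfSetting.isOpen_stabilizer_units C) (EtaleThetaDataOfSetting.finiteIndex_stabilizer_units C)
          (unitGroup ℚ_[p] (PadicAlgCl p)) (EtaleThetaDataOfSetting.pairRhoLim C α β hφ hAβ hH)) := by
  haveI : IsGalois ℚ_[p] (AlgebraicClosure ℚ_[p]) := {}
  haveI : T2Space (GQp p) := krullTopology_t2
  haveI := EtaleThetaDataOfSetting.finiteIndex_map_aug_decompPoint C hl.ne_zero gd y
  exact cor112_ii_model_of_cyclotomeTower C hC hS hl hp2 hpl hζ mods f hf hmods h15 L hZ hcharY hlim Env α hover δ hδ hαα γ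
    hγ hαγ huniq _ hDmu hfixD etaStd hmem hstd β hφ hAβ hH
    (EtaleThetaDataOfSetting.decompPoint_eq_one_of_aug_eq_one C hl.ne_zero gd y hy)
    (EtaleThetaDataOfSetting.isCompact_decompPoint C hl.ne_zero gd y) hO hΔ hα hβ τ hτ hdesc hrev hfree

/-- **[IUTchII] Cor. 1.12 (ii) AND (iii) at the model `Π := Π^tp_X̲̲`, for ONE theta-evaluation datum, with `D_{μ_-} := D_y`
INSTANTIATED — `hDq`, `hDc`, `[(D_{μ_-}.map ε).FiniteIndex]`, `[T2Space G_{ℚ_p}]` DISCHARGED.**  abc-iut-w4-d043's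
`cor112_model_of_cyclotomeTower` (one bijective `cU : Λ(ℚ̄_pˣ) ⥲ l·Δ_Θ` inverse to the model's identifications such that
BOTH the typed `Cor112_ii` AND the typed diagram `(†μ,×μ)` over the FULLY GENUINE [AbsTopIII]-output data `genuineOfModelIsm`,
last arrow the genuine `Ism(G)`-orbit, HOLD) at the pointed inversion whose decomposition group IS `D_y ⊆ Π^tp_X̲̲`, the
decomposition group of a non-cuspidal closed point `y` of the tree's tempered curve `X̲̲_v` ([IUTchII] Rmk. 1.4.1 (ii) p. 28
«the decomposition group of `(μ_-)_Ÿ`»): `hDq` by `inertia_eq_bot`, `hDc` by abc-iut-L3's `decompCompact_of_groupLevelData`,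
finite index by `isOpen_aug_decomp` + compactness of `G_{ℚ_p}`, Hausdorffness by `krullTopology_t2`.  Residual named inputs:
the Rmk. 1.4.1 (ii) data `α … huniq`, «`y = μ_-`» (`hDmu`, `hfixD`, `etaStd`/`hmem`/`hstd`), `β`/`hφ`/`hAβ`/`hH`, `hα`/`hβ`,
`τ`/`hτ`/`hdesc`/`hrev`/`hfree`, `hO` (F-2498), `hΔΘ` (G-w5d187-1), the producer's `ε`/(H1) `hΔX`/(H2) `hq`, and the L3
parameter bundle `gd`. [claim: Mochizuki2012, status: disputed] (IUTchII §1 Cor 1.12 (ii)(iii), kurims pp.56-58) -/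
theorem cor112_model_of_cyclotomeTower_decompPoint
    (hO : D.IsEtThOrigin) (hΔΘ : IsCompact (D.DeltaTheta : Set D.GtpTheta))
    (hα : ∀ x, EtaleThetaDataOfSetting.aug C (α x) = EtaleThetaDataOfSetting.aug C x)
    (hβ : ∀ a : D.GtpTheta, a ∈ D.lDeltaTheta l → β a = a)
    (τ : ℤ → (EtaleThetaDataOfSetting.coh C).H1 ⊤) (hτ : τ 0 = etaStd)
    (hdesc : ∀ o ∈ EtaleThetaDataOfSetting.orbitOne C hC,
      ∃ (n : ℤ) (c' : (EtaleThetaDataOfSetting.coh C).H1 ⊤), 2 • c' = 0 ∧ o = τ n + c')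
    (hrev : ∀ n : ℤ, IsOfFinAddOrder (EtaleThetaDataOfSetting.pairRho C α β hφ hAβ hH (τ n) - τ (-n)))
    (hfree : ∀ m n : ℤ, IsOfFinAddOrder (τ m - τ n) → m = n)
    (G : IsoClass (setting C hC hS hl hp2 hpl hζ mods f hf).Gk) :
    haveI := EtaleThetaDataOfSetting.finiteIndex_map_aug_decompPoint C hl.ne_zero gd y
    ∃ cU : CyclotomeCoefficients (EtaleThetaDataOfSetting.phi C) (D.lDeltaTheta l) (PadicAlgCl p)ˣ,
      Function.Bijective cU.hom ∧
      (∀ (ζ : Literature.AnabelianGeometry.EtaleTheta.cyclotome (PadicAlgCl p)ˣ) (M : ℕ+),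
        (((mods M).red (cU.hom ζ) : MuN p M) : (PadicAlgCl p)ˣ) = (ζ : ℕ+ → (PadicAlgCl p)ˣ) M) ∧
      Literature.IUT.HodgeArakelov.Cor112_ii
        (thetaEvaluation C hC hS hl hp2 hpl hζ mods f hf hmods h15 L hZ hcharY hlim Env
          (EtaleThetaDataOfSetting.pointedInversionOfPair C hC hS hcharY (setting C hC hS hl hp2 hpl hζ mods f hf)
            (ContinuousMulEquiv.refl _) rfl Env α hover δ hδ hαα γ hγ hαγ huniq ((C.temperedCurveXuuOfLevelData hl.ne_zero gd).decomp y) hDmu hfixD etaStd hmem hstd)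
          (LevelRetraction.ofAugmentation (EtaleThetaDataOfSetting.phi C) (D.lDeltaTheta l)
            (EtaleThetaDataOfSetting.aug C) ((C.temperedCurveXuuOfLevelData hl.ne_zero gd).decomp y) (EtaleThetaDataOfSetting.decompPoint_eq_one_of_aug_eq_one C hl.ne_zero gd y hy) (EtaleThetaDataOfSetting.PiYdd C)
            (EtaleThetaDataOfSetting.continuous_aug C) (aug_ker_acts_trivially C)
            (hlift_of_isCompact (EtaleThetaDataOfSetting.aug C) ((C.temperedCurveXuuOfLevelData hl.ne_zero gd).decomp y) (EtaleThetaDataOfSetting.continuous_aug C) (EtaleThetaDataOfSetting.isCompact_decompPoint C hl.ne_zero gd y))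
            (hemb_of_isCompact (EtaleThetaDataOfSetting.aug C) ((C.temperedCurveXuuOfLevelData hl.ne_zero gd).decomp y) (EtaleThetaDataOfSetting.continuous_aug C) (EtaleThetaDataOfSetting.isCompact_decompPoint C hl.ne_zero gd y) (EtaleThetaDataOfSetting.decompPoint_eq_one_of_aug_eq_one C hl.ne_zero gd y hy)))
          cU (EtaleThetaDataOfSetting.isOpen_stabilizer_units C) (EtaleThetaDataOfSetting.finiteIndex_stabilizer_units C)
          (unitGroup ℚ_[p] (PadicAlgCl p)) (EtaleThetaDataOfSetting.pairRhoLim C α β hφ hAβ hH)) ∧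
      ∃ Δ : MuXmuDiagram
          (thetaEvaluation C hC hS hl hp2 hpl hζ mods f hf hmods h15 L hZ hcharY hlim Env
            (EtaleThetaDataOfSetting.pointedInversionOfPair C hC hS hcharY (setting C hC hS hl hp2 hpl hζ mods f hf)
              (ContinuousMulEquiv.refl _) rfl Env α hover δ hδ hαα γ hγ hαγ huniq ((C.temperedCurveXuuOfLevelData hl.ne_zero gd).decomp y) hDmu hfixD etaStd hmem hstd)
            (LevelRetraction.ofAugmentation (EtaleThetaDataOfSetting.phi C) (D.lDeltaTheta l)
              (EtaleThetaDataOfSetting.aug C) ((C.temperedCurveXuuOfLevelData hl.ne_zero gd).decomp y) (EtaleThetaDataOfSetting.decompPoint_eq_one_of_aug_eq_one C hl.ne_zero gd y hy) (EtaleThetaDataOfSetting.PiYdd C)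
              (EtaleThetaDataOfSetting.continuous_aug C) (aug_ker_acts_trivially C)
              (hlift_of_isCompact (EtaleThetaDataOfSetting.aug C) ((C.temperedCurveXuuOfLevelData hl.ne_zero gd).decomp y) (EtaleThetaDataOfSetting.continuous_aug C) (EtaleThetaDataOfSetting.isCompact_decompPoint C hl.ne_zero gd y))
              (hemb_of_isCompact (EtaleThetaDataOfSetting.aug C) ((C.temperedCurveXuuOfLevelData hl.ne_zero gd).decomp y) (EtaleThetaDataOfSetting.continuous_aug C) (EtaleThetaDataOfSetting.isCompact_decompPoint C hl.ne_zero gd y) (EtaleThetaDataOfSetting.decompPoint_eq_one_of_aug_eq_one C hl.ne_zero gd y hy)))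
            cU (EtaleThetaDataOfSetting.isOpen_stabilizer_units C) (EtaleThetaDataOfSetting.finiteIndex_stabilizer_units C)
            (unitGroup ℚ_[p] (PadicAlgCl p)) (EtaleThetaDataOfSetting.pairRhoLim C α β hφ hAβ hH))
          (AbsTopMonoids.genuineOfModelIsm (setting C hC hS hl hp2 hpl hζ mods f hf) { k := k, K := PadicAlgCl p } ε hΔX hq) G
          ↥(AddCommGroup.torsion (thetaEnvData C hC hS hl hp2 hpl hζ mods f hf hmods h15 L hZ hcharY hlim).cohEnv.lim)
          (AddCommGroup.torsion (thetaEnvData C hC hS hl hp2 hpl hζ mods f hf hmods h15 L hZ hcharY hlim).cohEnv.lim).subtype,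
        Δ.poly₄₅ = {e | ∃ (φ : AbsTopMonoids.Genuine.qObj hq (IsoClass.base (setting C hC hS hl hp2 hpl hζ mods f hf).PiX) ⟶ G)
            (gI : (AbsTopMonoids.genuineOfModelIsm (setting C hC hS hl hp2 hpl hζ mods f hf) { k := k, K := PadicAlgCl p }
              ε hΔX hq).Ism G),
          ∀ (u : ↥(unitGroup ℚ_[p] (PadicAlgCl p)))
            (m : ↥(thetaEvaluation C hC hS hl hp2 hpl hζ mods f hf hmods h15 L hZ hcharY hlim Env
              (EtaleThetaDataOfSetting.pointedInversionOfPair C hC hS hcharY (setting C hC hS hl hp2 hpl hζ mods f hf)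
                (ContinuousMulEquiv.refl _) rfl Env α hover δ hδ hαα γ hγ hαγ huniq ((C.temperedCurveXuuOfLevelData hl.ne_zero gd).decomp y) hDmu hfixD etaStd hmem hstd)
              (LevelRetraction.ofAugmentation (EtaleThetaDataOfSetting.phi C) (D.lDeltaTheta l)
                (EtaleThetaDataOfSetting.aug C) ((C.temperedCurveXuuOfLevelData hl.ne_zero gd).decomp y) (EtaleThetaDataOfSetting.decompPoint_eq_one_of_aug_eq_one C hl.ne_zero gd y hy) (EtaleThetaDataOfSetting.PiYdd C)
                (EtaleThetaDataOfSetting.continuous_aug C) (aug_ker_acts_trivially C)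
                (hlift_of_isCompact (EtaleThetaDataOfSetting.aug C) ((C.temperedCurveXuuOfLevelData hl.ne_zero gd).decomp y) (EtaleThetaDataOfSetting.continuous_aug C) (EtaleThetaDataOfSetting.isCompact_decompPoint C hl.ne_zero gd y))
                (hemb_of_isCompact (EtaleThetaDataOfSetting.aug C) ((C.temperedCurveXuuOfLevelData hl.ne_zero gd).decomp y) (EtaleThetaDataOfSetting.continuous_aug C) (EtaleThetaDataOfSetting.isCompact_decompPoint C hl.ne_zero gd y) (EtaleThetaDataOfSetting.decompPoint_eq_one_of_aug_eq_one C hl.ne_zero gd y hy)))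
              cU (EtaleThetaDataOfSetting.isOpen_stabilizer_units C) (EtaleThetaDataOfSetting.finiteIndex_stabilizer_units C)
              (unitGroup ℚ_[p] (PadicAlgCl p)) (EtaleThetaDataOfSetting.pairRhoLim C α β hφ hAβ hH)).MxTM)
            (w : (nonzeroIntegers k (PadicAlgCl p))ˣ),
            (m : (thetaEvaluation C hC hS hl hp2 hpl hζ mods f hf hmods h15 L hZ hcharY hlim Env
              (EtaleThetaDataOfSetting.pointedInversionOfPair C hC hS hcharY (setting C hC hS hl hp2 hpl hζ mods f hf)
                (ContinuousMulEquiv.refl _) rfl Env α hover δ hδ hαα γ hγ hαγ huniq ((C.temperedCurveXuuOfLevelData hl.ne_zero gd).decomp y) hDmu hfixD etaStd hmem hstd)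
              (LevelRetraction.ofAugmentation (EtaleThetaDataOfSetting.phi C) (D.lDeltaTheta l)
                (EtaleThetaDataOfSetting.aug C) ((C.temperedCurveXuuOfLevelData hl.ne_zero gd).decomp y) (EtaleThetaDataOfSetting.decompPoint_eq_one_of_aug_eq_one C hl.ne_zero gd y hy) (EtaleThetaDataOfSetting.PiYdd C)
                (EtaleThetaDataOfSetting.continuous_aug C) (aug_ker_acts_trivially C)
                (hlift_of_isCompact (EtaleThetaDataOfSetting.aug C) ((C.temperedCurveXuuOfLevelData hl.ne_zero gd).decomp y) (EtaleThetaDataOfSetting.continuous_aug C) (EtaleThetaDataOfSetting.isCompact_decompPoint C hl.ne_zero gd y))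
                (hemb_of_isCompact (EtaleThetaDataOfSetting.aug C) ((C.temperedCurveXuuOfLevelData hl.ne_zero gd).decomp y) (EtaleThetaDataOfSetting.continuous_aug C) (EtaleThetaDataOfSetting.isCompact_decompPoint C hl.ne_zero gd y) (EtaleThetaDataOfSetting.decompPoint_eq_one_of_aug_eq_one C hl.ne_zero gd y hy)))
              cU (EtaleThetaDataOfSetting.isOpen_stabilizer_units C) (EtaleThetaDataOfSetting.finiteIndex_stabilizer_units C)
              (unitGroup ℚ_[p] (PadicAlgCl p)) (EtaleThetaDataOfSetting.pairRhoLim C α β hφ hAβ hH)).Hd) =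
                Multiplicative.toAdd (h1LimKummer (EtaleThetaDataOfSetting.phi C) (D.lDeltaTheta l) ((C.temperedCurveXuuOfLevelData hl.ne_zero gd).decomp y) cU
                  (EtaleThetaDataOfSetting.isOpen_stabilizer_units C) (EtaleThetaDataOfSetting.finiteIndex_stabilizer_units C) u) →
            ((w : nonzeroIntegers k (PadicAlgCl p)) : PadicAlgCl p) = ((u : (PadicAlgCl p)ˣ) : PadicAlgCl p) →
              e (Multiplicative.ofAdd (QuotientAddGroup.mk m)) =
                (AbsTopMonoids.genuineOfModelIsm (setting C hC hS hl hp2 hpl hζ mods f hf) { k := k, K := PadicAlgCl p }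
                    ε hΔX hq).actIsm G gI
                  (QuotientGroup.mk (Units.map (AbsTopMonoids.Genuine.liftM ({ k := k, K := PadicAlgCl p } : MLFClosure.{0})
                    (AbsTopMonoids.Genuine.phiOf ({ k := k, K := PadicAlgCl p } : MLFClosure.{0}) ε φ)).toMonoidHom w))} := by
  haveI : IsGalois ℚ_[p] (AlgebraicClosure ℚ_[p]) := {}
  haveI : T2Space (GQp p) := krullTopology_t2
  haveI := EtaleThetaDataOfSetting.finiteIndex_map_aug_decompPoint C hl.ne_zero gd y
  exact cor112_model_of_cyclotomeTower C hC hS hl hp2 hpl hζ mods f hf hmods h15 L hZ hcharY hlim Env α hover δ hδ hαα γ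
    hγ hαγ huniq _ hDmu hfixD etaStd hmem hstd β hφ hAβ hH
    (EtaleThetaDataOfSetting.decompPoint_eq_one_of_aug_eq_one C hl.ne_zero gd y hy)
    (EtaleThetaDataOfSetting.isCompact_decompPoint C hl.ne_zero gd y) k ε hΔX hq hO hΔΘ hα hβ τ hτ hdesc hrev hfree G

end EtaleLevels

end Literature.IUT.HodgeArakelov

end
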